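import Summits.Ventures.WeilGRH.TwistedComplexTailJ
import Summits.Ventures.WeilGRH.TwistedComplexCertificateReal
import Summits.RiemannHypothesis.RiemannHypothesis.Theorems.WeilFormatCDataRung
import HarnessLib

/-!
# GRH arm (rh-explicit, venture WeilGRH): twisted format C for a COMPLEX character — the two-sided order-`J` tail as an
  explicit matrix and the DATA-ONLY front door on the enumeration `κ`

Cell `rh-explicit`, WEIL TRACK — GRH ARM (lit/typing seat weil-grh-5 gen11).  Sequel of `TwistedComplexTailJ.lean` and
`TwistedComplexCertificateReal.lean`.  On the enumeration `κ(p) = 2|p| − 1` (`p > 0`), `2|p|` (`p ≤ 0`) of the modes the far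
`j`-indices pair off as `(2m − 1, 2m) ↔ (m, −m)` (`sum_Ico_enum_two_sided`), so the `j`-tail of the real kernel
`M(κp, κp') = Re twistedGramCoeffC χ a p p'` is the positive-side plus the negative-side Cauchy tail of
`TwistedComplexTailJ.lean` (`complex_tailJ_majorant_enum`), an explicit `(2B−1) × (2B−1)` matrix `U₂`
(`complex_tailJ_majorant_matrix`).  With weil-10's exact-column majorant and split ∀N soundness:

* `weilPositivityOnChar_of_twistedC_formatC_dataJ` — `q ≠ 1`, ANY χ mod `q` (complex values included), `a > 0`; a symmetric
  table `M` with `M(κp, κp') = Re G^χ(p,p')` (`hM`); block `B ≥ 2` (modes `|p| < B`, `j < 2B − 1`), exact columns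
  `B ≤ |m| < B₃` (`2B ≤ B₃`; `j ∈ Ico (2B−1) (2B₃−1)`) with weights `0 < w_j ≤ W((j+1)/2)`, order `J`, Hankel weights `lam`,
  Peter–Paul `θ, η > 0`, TWO numeric sign facts (`h0` at `B`, `hd0` at `B₃`, through the monotone core of the far weight
  `W(n) = 2e⁻_B(n) − A_op⁺(a) + log q` and the bound `π/4` on the Hilbert arctan penalty) and ONE kernel certificate
  `∀ x, 0 ≤ Σ x_i x_{i'} (M(i,i') − Σ_j M(i,j)M(i',j)/w_j − U₂(i,i'))` ⟹ `WeilPositivityOnChar χ a`.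

This completes format C for complex characters at every tail order: every remaining premise is a finite inequality between
explicit reals or ONE PSD check of size `2B − 1`.  No definitions; no named facts; RH/GRH-free; standard axioms.
-/

set_option autoImplicit false

noncomputable section

open Complex Finset Matrix
open scoped Real BigOperators ComplexConjugate ArithmeticFunction.vonMangoldt

namespace Summit.Ventures.WeilGRH

open Literature.NumberTheory.LFunctions
open Literature.NumberTheory.LFunctions.Yoshida1992 (modes freq mem_modes archExpSumSin)
open Literature.Analysis.SpecialFunctions
open Summit.RiemannHypothesis.RiemannHypothesis.Theorems.WeilFormatC

variable {q : ℕ} {a : ℝ}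

/-! ## The two-sided tail on the enumeration -/

section TwoSided

/-- `Σ_{j ∈ Ico (2B₃−1) (2N''+1)} f j = Σ_{m ∈ Ico B₃ (N''+1)} (f(2m−1) + f(2m))` (`B₃ ≥ 1`): the far `j`-indices of the
enumeration `κ` pair off as `(2m−1, 2m) ↔ (m, −m)`. -/
theorem sum_Ico_enum_two_sided (f : ℕ → ℝ) {B₃ : ℕ} (hB₃ : 1 ≤ B₃) (N'' : ℕ) :
    ∑ j ∈ Finset.Ico (2 * B₃ - 1) (2 * N'' + 1), f j = ∑ m ∈ Finset.Ico B₃ (N'' + 1), (f (2 * m - 1) + f (2 * m)) := by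
  induction N'' with
  | zero =>
    rw [Finset.Ico_eq_empty_of_le (by omega : 2 * 0 + 1 ≤ 2 * B₃ - 1), Finset.Ico_eq_empty_of_le (by omega : 0 + 1 ≤ B₃),
      Finset.sum_empty, Finset.sum_empty]
  | succ N ih =>
    by_cases hN : B₃ ≤ N + 1
    · rw [show 2 * (N + 1) + 1 = 2 * N + 1 + 1 + 1 by ring,
        Finset.sum_Ico_succ_top (by omega : 2 * B₃ - 1 ≤ 2 * N + 1 + 1),
        Finset.sum_Ico_succ_top (by omega : 2 * B₃ - 1 ≤ 2 * N + 1), ih,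
        Finset.sum_Ico_succ_top (by omega : B₃ ≤ N + 1),
        show 2 * (N + 1) - 1 = 2 * N + 1 by omega, show 2 * (N + 1) = 2 * N + 1 + 1 by ring]
      ring
    · rw [Finset.Ico_eq_empty_of_le (by omega : 2 * (N + 1) + 1 ≤ 2 * B₃ - 1),
        Finset.Ico_eq_empty_of_le (by omega : N + 1 + 1 ≤ B₃), Finset.sum_empty, Finset.sum_empty]

/-- One-sided truncations are dominated by the paired sum (nonnegative terms). -/
theorem sum_Ico_enum_le_two_sided (f : ℕ → ℝ) {B₃ : ℕ} (hB₃ : 1 ≤ B₃) (hf : ∀ j, 2 * B₃ - 1 ≤ j → 0 ≤ f j) (N' : ℕ) :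
    ∑ j ∈ Finset.Ico (2 * B₃ - 1) N', f j ≤ ∑ m ∈ Finset.Ico B₃ (N' + 1), (f (2 * m - 1) + f (2 * m)) := by
  rw [← sum_Ico_enum_two_sided f hB₃ N']
  exact Finset.sum_le_sum_of_subset_of_nonneg (Finset.Ico_subset_Ico_right (by omega))
    fun j hj _ ↦ hf j (Finset.mem_Ico.mp hj).1

/-- **The order-`J` tail majorant of the complex-character kernel on the enumeration** `κ` (far `j ≥ 2B₃ − 1`, i.e.
`|m| ≥ B₃`; weights `d((j+1)/2) = d(|m|)`): the positive-side bound plus the negative-side bound. -/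
theorem complex_tailJ_majorant_enum (χ : DirichletCharacter ℂ q) (ha : 0 < a) {B B₃ : ℕ} (hB : 1 ≤ B)
    (hBB : 2 * B ≤ B₃) (J : ℕ) (lam : Fin J → ℝ) (hlam : ∀ j, 0 < lam j)
    (d : ℕ → ℝ) {d₀ : ℝ} (hd₀ : 0 < d₀) (hd : ∀ m, B₃ ≤ m → d₀ ≤ d m) {θ η : ℝ} (hθ : 0 < θ) (hη : 0 < η)
    (N' : ℕ) (x : Fin (2 * B - 1) → ℝ) :
    ∑ j ∈ Finset.Ico (2 * B₃ - 1) N', (∑ i : Fin (2 * B - 1),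
        (twistedGramCoeffC χ a (if (i : ℕ) % 2 = 1 then ((((i : ℕ) + 1) / 2 : ℕ) : ℤ) else -((((i : ℕ) / 2 : ℕ) : ℤ))) (if j % 2 = 1 then (((j + 1) / 2 : ℕ) : ℤ) else -((j / 2 : ℕ) : ℤ))).re * x i) ^ 2 / d ((j + 1) / 2)
      ≤ ((1 + θ) * (1 + η) * ((π / 4 + (∑ k ∈ weilPrimeIndex a, (Λ k : ℝ) / Real.sqrt k) + a * (1 + weilArchDensity (2 * a)) / (π * B₃)) ^ 2 / (π ^ 2 * d₀))
          * ((∑ j : Fin J, ∑ j' : Fin J, (∑ i : Fin (2 * B - 1), ((-1 : ℝ) ^ (if (i : ℕ) % 2 = 1 then ((((i : ℕ) + 1) / 2 : ℕ) : ℤ) else -((((i : ℕ) / 2 : ℕ) : ℤ))) * (((if (i : ℕ) % 2 = 1 then ((((i : ℕ) + 1) / 2 : ℕ) : ℤ) else -((((i : ℕ) / 2 : ℕ) : ℤ))) : ℤ) : ℝ) ^ (j : ℕ)) * x i) * (∑ i : Fin (2 * B - 1), ((-1 : ℝ) ^ (if (i : ℕ) % 2 = 1 then ((((i : ℕ) +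 1) / 2 : ℕ) : ℤ) else -((((i : ℕ) / 2 : ℕ) : ℤ))) * (((if (i : ℕ) % 2 = 1 then ((((i : ℕ) + 1) / 2 : ℕ) : ℤ) else -((((i : ℕ) / 2 : ℕ) : ℤ))) : ℤ) : ℝ) ^ (j' : ℕ)) * x i)
                * ((1 / ((((j : ℕ) + 1) + ((j' : ℕ) + 1) - 1 : ℕ) * (((B₃ - 1 : ℕ) : ℝ)) ^ (((j : ℕ) + 1) + ((j' : ℕ) + 1) - 1))
                    + 1 / ((((j : ℕ) + 1) + ((j' : ℕ) + 1) - 1 : ℕ) * (B₃ : ℝ) ^ (((j : ℕ) + 1) + ((j' : ℕ) + 1) - 1))) / 2))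
              + ∑ j : Fin J, (∑ i : Fin (2 * B - 1), ((-1 : ℝ) ^ (if (i : ℕ) % 2 = 1 then ((((i : ℕ) + 1) / 2 : ℕ) : ℤ) else -((((i : ℕ) / 2 : ℕ) : ℤ))) * (((if (i : ℕ) % 2 = 1 then ((((i : ℕ) + 1) / 2 : ℕ) : ℤ) else -((((i : ℕ) / 2 : ℕ) : ℤ))) : ℤ) : ℝ) ^ (j : ℕ)) * x i) ^ 2 * ∑ j' : Fin J,
                  ((1 / ((((j : ℕ) + 1) + ((j' : ℕ) + 1) - 1 : ℕ) * (((B₃ - 1 : ℕ) : ℝ)) ^ (((j : ℕ) + 1) + ((j' : ℕ) + 1) - 1))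
                    - 1 / ((((j : ℕ) + 1) + ((j' : ℕ) + 1) - 1 : ℕ) * (B₃ : ℝ) ^ (((j : ℕ) + 1) + ((j' : ℕ) + 1) - 1))) / 2)
                  * lam j' / lam j)
        + (1 + θ) * (1 + η⁻¹) * (1 / d₀)
          * ((∑ j : Fin J, ∑ j' : Fin J, (∑ i : Fin (2 * B - 1), ((-1 : ℝ) ^ (if (i : ℕ) % 2 = 1 then ((((i : ℕ) + 1) / 2 : ℕ) : ℤ) else -((((i : ℕ) / 2 : ℕ) : ℤ))) * (-((((if (i : ℕ) % 2 = 1 then ((((i : ℕ) + 1) / 2 : ℕ) : ℤ) else -((((i : ℕ) / 2 : ℕ) : ℤ))) : ℤ) : ℝ) ^ (j : ℕ)) * ((Complex.digamma (1 / 4 + ((freq a (if (i : ℕ) % 2 = 1 then ((((i : ℕ) + 1) / 2 : ℕ) : ℤ) else -((((i : ℕ) / 2 : ℕ) : ℤ))) : ℝ) : ℂ) / 2 * I)).im / 2 + (∑ k ∈ weilPrimeIndex a, (Λ k : ℝ) / Real.sqrt k * ((χ (k : ZMod q)).re * Real.sin (freq a (if (i : ℕ) % 2 = 1 then ((((i :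 ℕ) + 1) / 2 : ℕ) : ℤ) else -((((i : ℕ) / 2 : ℕ) : ℤ))) * Real.log k) + (χ (k : ZMod q)).im * Real.cos (freq a (if (i : ℕ) % 2 = 1 then ((((i : ℕ) + 1) / 2 : ℕ) : ℤ) else -((((i : ℕ) / 2 : ℕ) : ℤ))) * Real.log k))) - archExpSumSin a (if (i : ℕ) % 2 = 1 then ((((i : ℕ) + 1) / 2 : ℕ) : ℤ) else -((((i : ℕ) / 2 : ℕ) : ℤ)))) / π)) * x i) * (∑ i : Fin (2 * B - 1), ((-1 : ℝ) ^ (if (i : ℕ) % 2 = 1 then ((((i : ℕ) + 1) / 2 : ℕ) : ℤ) else -((((i : ℕ) / 2 : ℕ) : ℤ))) * (-((((if (i : ℕ) % 2 = 1 then ((((i : ℕ) + 1) / 2 : ℕ) : ℤ) else -((((i : ℕ) / 2 : ℕ) : ℤ))) : ℤ) : ℝ) ^ (j' : ℕ)) * ((Complex.digamma (1 / 4 + ((freq a (if (i : ℕ) % 2 = 1 then ((((i : ℕ) + 1) / 2 : ℕ) : ℤ) else -((((i : ℕ) / 2 : ℕ) : ℤ))) : ℝ) : ℂ) / 2 * I)).im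 / 2 + (∑ k ∈ weilPrimeIndex a, (Λ k : ℝ) / Real.sqrt k * ((χ (k : ZMod q)).re * Real.sin (freq a (if (i : ℕ) % 2 = 1 then ((((i : ℕ) + 1) / 2 : ℕ) : ℤ) else -((((i : ℕ) / 2 : ℕ) : ℤ))) * Real.log k) + (χ (k : ZMod q)).im * Real.cos (freq a (if (i : ℕ) % 2 = 1 then ((((i : ℕ) + 1) / 2 : ℕ) : ℤ) else -((((i : ℕ) / 2 : ℕ) : ℤ))) * Real.log k))) - archExpSumSin a (if (i : ℕ) % 2 = 1 then ((((i : ℕ) + 1) / 2 : ℕ) : ℤ) else -((((i : ℕ) / 2 : ℕ) : ℤ)))) / π)) * x i)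
                * ((1 / ((((j : ℕ) + 1) + ((j' : ℕ) + 1) - 1 : ℕ) * (((B₃ - 1 : ℕ) : ℝ)) ^ (((j : ℕ) + 1) + ((j' : ℕ) + 1) - 1))
                    + 1 / ((((j : ℕ) + 1) + ((j' : ℕ) + 1) - 1 : ℕ) * (B₃ : ℝ) ^ (((j : ℕ) + 1) + ((j' : ℕ) + 1) - 1))) / 2))
              + ∑ j : Fin J, (∑ i : Fin (2 * B - 1), ((-1 : ℝ) ^ (if (i : ℕ) % 2 = 1 then ((((i : ℕ) + 1) / 2 : ℕ) : ℤ) else -((((i : ℕ) / 2 : ℕ) : ℤ))) * (-((((if (i : ℕ) % 2 = 1 then ((((i : ℕ) + 1) / 2 : ℕ) : ℤ) else -((((i : ℕ) / 2 : ℕ) : ℤ))) : ℤ) : ℝ) ^ (j : ℕ)) * ((Complex.digamma (1 / 4 + ((freq a (if (i : ℕ) % 2 = 1 then ((((i : ℕ) + 1) / 2 : ℕ) : ℤ) else -((((i : ℕ) / 2 : ℕ) : ℤ))) : ℝ) : ℂ) / 2 * I)).im / 2 + (∑ k ∈ weilPrimeIndex a, (Λ k : ℝ) / Real.sqrt k *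 ((χ (k : ZMod q)).re * Real.sin (freq a (if (i : ℕ) % 2 = 1 then ((((i : ℕ) + 1) / 2 : ℕ) : ℤ) else -((((i : ℕ) / 2 : ℕ) : ℤ))) * Real.log k) + (χ (k : ZMod q)).im * Real.cos (freq a (if (i : ℕ) % 2 = 1 then ((((i : ℕ) + 1) / 2 : ℕ) : ℤ) else -((((i : ℕ) / 2 : ℕ) : ℤ))) * Real.log k))) - archExpSumSin a (if (i : ℕ) % 2 = 1 then ((((i : ℕ) + 1) / 2 : ℕ) : ℤ) else -((((i : ℕ) / 2 : ℕ) : ℤ)))) / π)) * x i) ^ 2 * ∑ j' : Fin J,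
                  ((1 / ((((j : ℕ) + 1) + ((j' : ℕ) + 1) - 1 : ℕ) * (((B₃ - 1 : ℕ) : ℝ)) ^ (((j : ℕ) + 1) + ((j' : ℕ) + 1) - 1))
                    - 1 / ((((j : ℕ) + 1) + ((j' : ℕ) + 1) - 1 : ℕ) * (B₃ : ℝ) ^ (((j : ℕ) + 1) + ((j' : ℕ) + 1) - 1))) / 2)
                  * lam j' / lam j)
        + (1 + θ⁻¹) * (((2 * B - 1 : ℕ) : ℝ) / (d₀ * ((2 * J + 1 : ℕ) * (((B₃ - 1 : ℕ) : ℝ)) ^ (2 * J + 1))))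
          * ∑ i : Fin (2 * B - 1), (4 * (π / 4 + (∑ k ∈ weilPrimeIndex a, (Λ k : ℝ) / Real.sqrt k) + a * (1 + weilArchDensity (2 * a)) / π) * (((if (i : ℕ) % 2 = 1 then ((((i : ℕ) + 1) / 2 : ℕ) : ℤ) else -((((i : ℕ) / 2 : ℕ) : ℤ)))).natAbs : ℝ) ^ J / π) ^ 2 * x i ^ 2)
        + ((1 + θ) * (1 + η) * ((π / 4 + (∑ k ∈ weilPrimeIndex a, (Λ k : ℝ) / Real.sqrt k) + a * (1 + weilArchDensity (2 * a)) / (π * B₃)) ^ 2 / (π ^ 2 * d₀))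
          * ((∑ j : Fin J, ∑ j' : Fin J, (∑ i : Fin (2 * B - 1), ((-1 : ℝ) ^ ((j : ℕ) + 1) * ((-1 : ℝ) ^ (if (i : ℕ) % 2 = 1 then ((((i : ℕ) + 1) / 2 : ℕ) : ℤ) else -((((i : ℕ) / 2 : ℕ) : ℤ))) * (((if (i : ℕ) % 2 = 1 then ((((i : ℕ) + 1) / 2 : ℕ) : ℤ) else -((((i : ℕ) / 2 : ℕ) : ℤ))) : ℤ) : ℝ) ^ (j : ℕ))) * x i) * (∑ i : Fin (2 * B - 1), ((-1 : ℝ) ^ ((j' : ℕ) + 1) * ((-1 : ℝ) ^ (if (i : ℕ) % 2 = 1 then ((((i : ℕ) + 1) / 2 : ℕ) : ℤ) else -((((i : ℕ) / 2 : ℕ) : ℤ))) * (((if (i : ℕ) % 2 = 1 then ((((i : ℕ) + 1) / 2 : ℕ) : ℤ) else -((((i : ℕ) / 2 : ℕ) : ℤ))) : ℤ) : ℝ) ^ (j' : ℕ))) * x i)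
                * ((1 / ((((j : ℕ) + 1) + ((j' : ℕ) + 1) - 1 : ℕ) * (((B₃ - 1 : ℕ) : ℝ)) ^ (((j : ℕ) + 1) + ((j' : ℕ) + 1) - 1))
                    + 1 / ((((j : ℕ) + 1) + ((j' : ℕ) + 1) - 1 : ℕ) * (B₃ : ℝ) ^ (((j : ℕ) + 1) + ((j' : ℕ) + 1) - 1))) / 2))
              + ∑ j : Fin J, (∑ i : Fin (2 * B - 1), ((-1 : ℝ) ^ ((j : ℕ) + 1) * ((-1 : ℝ) ^ (if (i : ℕ) % 2 = 1 then ((((i : ℕ) + 1) / 2 : ℕ) : ℤ) else -((((i : ℕ) / 2 : ℕ) : ℤ))) * (((if (i : ℕ) % 2 = 1 then ((((i : ℕ) + 1) / 2 : ℕ) : ℤ) else -((((i : ℕ) / 2 : ℕ) : ℤ))) : ℤ) : ℝ) ^ (j : ℕ))) * x i) ^ 2 * ∑ j' : Fin J,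
                  ((1 / ((((j : ℕ) + 1) + ((j' : ℕ) + 1) - 1 : ℕ) * (((B₃ - 1 : ℕ) : ℝ)) ^ (((j : ℕ) + 1) + ((j' : ℕ) + 1) - 1))
                    - 1 / ((((j : ℕ) + 1) + ((j' : ℕ) + 1) - 1 : ℕ) * (B₃ : ℝ) ^ (((j : ℕ) + 1) + ((j' : ℕ) + 1) - 1))) / 2)
                  * lam j' / lam j)
        + (1 + θ) * (1 + η⁻¹) * (1 / d₀)
          * ((∑ j : Fin J, ∑ j' : Fin J, (∑ i : Fin (2 * B - 1), ((-1 : ℝ) ^ ((j : ℕ) + 1) * ((-1 : ℝ) ^ (if (i : ℕ) % 2 = 1 then ((((i : ℕ) + 1) / 2 : ℕ) : ℤ) else -((((i : ℕ) / 2 : ℕ) : ℤ))) * (-((((if (i : ℕ) % 2 = 1 then ((((i : ℕ) + 1) / 2 : ℕ) : ℤ) else -((((i : ℕ) / 2 : ℕ) : ℤ))) : ℤ) : ℝ) ^ (j : ℕ)) * ((Complex.digamma (1 / 4 + ((freq a (if (i : ℕ) % 2 = 1 then ((((i : ℕ) + 1) / 2 : ℕ) : ℤ) else -((((i : ℕ)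 / 2 : ℕ) : ℤ))) : ℝ) : ℂ) / 2 * I)).im / 2 + (∑ k ∈ weilPrimeIndex a, (Λ k : ℝ) / Real.sqrt k * ((χ (k : ZMod q)).re * Real.sin (freq a (if (i : ℕ) % 2 = 1 then ((((i : ℕ) + 1) / 2 : ℕ) : ℤ) else -((((i : ℕ) / 2 : ℕ) : ℤ))) * Real.log k) + (χ (k : ZMod q)).im * Real.cos (freq a (if (i : ℕ) % 2 = 1 then ((((i : ℕ) + 1) / 2 : ℕ) : ℤ) else -((((i : ℕ) / 2 : ℕ) : ℤ))) * Real.log k))) - archExpSumSin a (if (i : ℕ) % 2 = 1 then ((((i : ℕ) + 1) / 2 : ℕ) : ℤ) else -((((i : ℕ) / 2 : ℕ) : ℤ)))) / π))) * x i) * (∑ i : Fin (2 * B - 1), ((-1 : ℝ) ^ ((j' : ℕ) + 1) * ((-1 : ℝ) ^ (if (i : ℕ) % 2 = 1 then ((((i : ℕ) + 1) / 2 : ℕ) : ℤ) else -((((i : ℕ) / 2 : ℕ) : ℤ))) * (-((((if (i : ℕ) % 2 = 1 then ((((i : ℕ) + 1) / 2 : ℕ) : ℤ) else -((((i : ℕ)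 / 2 : ℕ) : ℤ))) : ℤ) : ℝ) ^ (j' : ℕ)) * ((Complex.digamma (1 / 4 + ((freq a (if (i : ℕ) % 2 = 1 then ((((i : ℕ) + 1) / 2 : ℕ) : ℤ) else -((((i : ℕ) / 2 : ℕ) : ℤ))) : ℝ) : ℂ) / 2 * I)).im / 2 + (∑ k ∈ weilPrimeIndex a, (Λ k : ℝ) / Real.sqrt k * ((χ (k : ZMod q)).re * Real.sin (freq a (if (i : ℕ) % 2 = 1 then ((((i : ℕ) + 1) / 2 : ℕ) : ℤ) else -((((i : ℕ) / 2 : ℕ) : ℤ))) * Real.log k) + (χ (k : ZMod q)).im * Real.cos (freq a (if (i : ℕ) % 2 = 1 then ((((i : ℕ) + 1) / 2 : ℕ) : ℤ) else -((((i : ℕ) / 2 : ℕ) : ℤ))) * Real.log k))) - archExpSumSin a (if (i : ℕ) % 2 = 1 then ((((i : ℕ) + 1) / 2 : ℕ) : ℤ) else -((((i : ℕ) / 2 : ℕ) : ℤ)))) / π))) * x i)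
                * ((1 / ((((j : ℕ) + 1) + ((j' : ℕ) + 1) - 1 : ℕ) * (((B₃ - 1 : ℕ) : ℝ)) ^ (((j : ℕ) + 1) + ((j' : ℕ) + 1) - 1))
                    + 1 / ((((j : ℕ) + 1) + ((j' : ℕ) + 1) - 1 : ℕ) * (B₃ : ℝ) ^ (((j : ℕ) + 1) + ((j' : ℕ) + 1) - 1))) / 2))
              + ∑ j : Fin J, (∑ i : Fin (2 * B - 1), ((-1 : ℝ) ^ ((j : ℕ) + 1) * ((-1 : ℝ) ^ (if (i : ℕ) % 2 = 1 then ((((i : ℕ) + 1) / 2 : ℕ) : ℤ) else -((((i : ℕ) / 2 : ℕ) : ℤ))) * (-((((if (i : ℕ) % 2 = 1 then ((((i : ℕ) + 1) / 2 : ℕ) : ℤ) else -((((i : ℕ) / 2 : ℕ) : ℤ))) : ℤ) : ℝ) ^ (j : ℕ)) * ((Complex.digamma (1 / 4 + ((freq a (if (i : ℕ) % 2 = 1 then ((((i : ℕ) + 1) / 2 : ℕ) : ℤ) else -((((i : ℕ) / 2 : ℕ) : ℤ))) : ℝ) : ℂ) / 2 * I)).im / 2 + (∑ k ∈ weilPrimeIndex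 a, (Λ k : ℝ) / Real.sqrt k * ((χ (k : ZMod q)).re * Real.sin (freq a (if (i : ℕ) % 2 = 1 then ((((i : ℕ) + 1) / 2 : ℕ) : ℤ) else -((((i : ℕ) / 2 : ℕ) : ℤ))) * Real.log k) + (χ (k : ZMod q)).im * Real.cos (freq a (if (i : ℕ) % 2 = 1 then ((((i : ℕ) + 1) / 2 : ℕ) : ℤ) else -((((i : ℕ) / 2 : ℕ) : ℤ))) * Real.log k))) - archExpSumSin a (if (i : ℕ) % 2 = 1 then ((((i : ℕ) + 1) / 2 : ℕ) : ℤ) else -((((i : ℕ) / 2 : ℕ) : ℤ)))) / π))) * x i) ^ 2 * ∑ j' : Fin J,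
                  ((1 / ((((j : ℕ) + 1) + ((j' : ℕ) + 1) - 1 : ℕ) * (((B₃ - 1 : ℕ) : ℝ)) ^ (((j : ℕ) + 1) + ((j' : ℕ) + 1) - 1))
                    - 1 / ((((j : ℕ) + 1) + ((j' : ℕ) + 1) - 1 : ℕ) * (B₃ : ℝ) ^ (((j : ℕ) + 1) + ((j' : ℕ) + 1) - 1))) / 2)
                  * lam j' / lam j)
        + (1 + θ⁻¹) * (((2 * B - 1 : ℕ) : ℝ) / (d₀ * ((2 * J + 1 : ℕ) * (((B₃ - 1 : ℕ) : ℝ)) ^ (2 * J + 1))))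
          * ∑ i : Fin (2 * B - 1), (4 * (π / 4 + (∑ k ∈ weilPrimeIndex a, (Λ k : ℝ) / Real.sqrt k) + a * (1 + weilArchDensity (2 * a)) / π) * (((if (i : ℕ) % 2 = 1 then ((((i : ℕ) + 1) / 2 : ℕ) : ℤ) else -((((i : ℕ) / 2 : ℕ) : ℤ)))).natAbs : ℝ) ^ J / π) ^ 2 * x i ^ 2) := by
  have hB₃1 : 1 ≤ B₃ := by omega
  have hpos := complex_tailJ_majorant_pos χ ha hB hBB J lam hlam d hd₀ hd hθ hη (N' + 1) x
  have hneg := complex_tailJ_majorant_neg χ ha hB hBB J lam hlam d hd₀ hd hθ hη (N' + 1) x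
  refine (sum_Ico_enum_le_two_sided _ hB₃1 (fun j hj ↦ ?_) N').trans ?_
  · have hdj : 0 < d ((j + 1) / 2) := lt_of_lt_of_le hd₀ (hd _ (by omega))
    positivity
  rw [Finset.sum_add_distrib]
  refine (add_le_add (le_of_eq ?_) (le_of_eq ?_)).trans (add_le_add hpos hneg)
  · refine Finset.sum_congr rfl fun m hm ↦ ?_
    have hm1 : 1 ≤ m := le_trans hB₃1 (Finset.mem_Ico.mp hm).1
    have e1 : (2 * m - 1) % 2 = 1 := by omega
    have e2 : (2 * m - 1 + 1) / 2 = m := by omega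
    simp only [if_pos e1, e2]
  · refine Finset.sum_congr rfl fun m hm ↦ ?_
    have e3 : ¬ (2 * m) % 2 = 1 := by omega
    have e4 : 2 * m / 2 = m := by omega
    have e5 : (2 * m + 1) / 2 = m := by omega
    simp only [if_neg e3, e4, e5]

end TwoSided

/-! ## The tail majorant as an explicit matrix -/

section MatrixForm

/-- `κ(ι(n)) = n`: the enumeration inverts the mode map. -/
theorem kappa_iota (n : ℕ) :
    (if (0 : ℤ) < (if n % 2 = 1 then (((n + 1) / 2 : ℕ) : ℤ) else -((n / 2 : ℕ) : ℤ))
      then 2 * (if n % 2 = 1 then (((n + 1) / 2 : ℕ) : ℤ) else -((n / 2 : ℕ) : ℤ)).natAbs - 1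
      else 2 * (if n % 2 = 1 then (((n + 1) / 2 : ℕ) : ℤ) else -((n / 2 : ℕ) : ℤ)).natAbs) = n := by
  split_ifs with h1 h2 h2 <;> simp only [Int.natAbs_neg, Int.natAbs_natCast] at * <;> omega

/-- **The two-sided order-`J` tail majorant as `xᵀU₂x`** (`hU₂` shape of `sum_range_mul_mul_nonneg_of_certificate_sum_split`). -/
theorem complex_tailJ_majorant_matrix (χ : DirichletCharacter ℂ q) (ha : 0 < a) {B B₃ : ℕ} (hB : 1 ≤ B)
    (hBB : 2 * B ≤ B₃) (J : ℕ) (lam : Fin J → ℝ) (hlam : ∀ j, 0 < lam j)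
    (d : ℕ → ℝ) {d₀ : ℝ} (hd₀ : 0 < d₀) (hd : ∀ m, B₃ ≤ m → d₀ ≤ d m) {θ η : ℝ} (hθ : 0 < θ) (hη : 0 < η)
    (N' : ℕ) (x : Fin (2 * B - 1) → ℝ) :
    ∑ j ∈ Finset.Ico (2 * B₃ - 1) N', (∑ i : Fin (2 * B - 1),
        (twistedGramCoeffC χ a (if (i : ℕ) % 2 = 1 then ((((i : ℕ) + 1) / 2 : ℕ) : ℤ) else -((((i : ℕ) / 2 : ℕ) : ℤ))) (if j % 2 = 1 then (((j + 1) / 2 : ℕ) : ℤ) else -((j / 2 : ℕ) : ℤ))).re * x i) ^ 2 / d ((j + 1) / 2)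
      ≤ x ⬝ᵥ (Matrix.of fun i i' : Fin (2 * B - 1) ↦
          ((1 + θ) * (1 + η) * ((π / 4 + (∑ k ∈ weilPrimeIndex a, (Λ k : ℝ) / Real.sqrt k) + a * (1 + weilArchDensity (2 * a)) / (π * B₃)) ^ 2 / (π ^ 2 * d₀)) * (∑ j : Fin J, ∑ j' : Fin J, (((1 / ((((j : ℕ) + 1) + ((j' : ℕ) + 1) - 1 : ℕ) * (((B₃ - 1 : ℕ) : ℝ)) ^ (((j : ℕ) + 1) + ((j' : ℕ) + 1) - 1)) + 1 / ((((j : ℕ) + 1) + ((j' : ℕ) + 1) - 1 : ℕ) * (B₃ : ℝ) ^ (((j : ℕ) + 1) + ((j' : ℕ) + 1) - 1))) / 2) + (if j = j' then (∑ j' : Fin J, ((1 / ((((j : ℕ) + 1) + ((j' : ℕ) + 1) - 1 : ℕ) * (((B₃ - 1 : ℕ) : ℝ)) ^ (((j : ℕ) + 1) + ((j' : ℕ) + 1) - 1)) - 1 / ((((j : ℕ) + 1) + ((j' : ℕ) + 1) - 1 : ℕ) * (B₃ : ℝ) ^ (((j : ℕ) + 1) + ((j' : ℕ) + 1) - 1)))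 / 2) * lam j' / lam j) else 0)) * ((-1 : ℝ) ^ (if (i : ℕ) % 2 = 1 then ((((i : ℕ) + 1) / 2 : ℕ) : ℤ) else -((((i : ℕ) / 2 : ℕ) : ℤ))) * (((if (i : ℕ) % 2 = 1 then ((((i : ℕ) + 1) / 2 : ℕ) : ℤ) else -((((i : ℕ) / 2 : ℕ) : ℤ))) : ℤ) : ℝ) ^ (j : ℕ)) * ((-1 : ℝ) ^ (if (i' : ℕ) % 2 = 1 then ((((i' : ℕ) + 1) / 2 : ℕ) : ℤ) else -((((i' : ℕ) / 2 : ℕ) : ℤ))) * (((if (i' : ℕ) % 2 = 1 then ((((i' : ℕ) + 1) / 2 : ℕ) : ℤ) else -((((i' : ℕ) / 2 : ℕ) : ℤ))) : ℤ) : ℝ) ^ (j' : ℕ)))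
            + (1 + θ) * (1 + η⁻¹) * (1 / d₀) * (∑ j : Fin J, ∑ j' : Fin J, (((1 / ((((j : ℕ) + 1) + ((j' : ℕ) + 1) - 1 : ℕ) * (((B₃ - 1 : ℕ) : ℝ)) ^ (((j : ℕ) + 1) + ((j' : ℕ) + 1) - 1)) + 1 / ((((j : ℕ) + 1) + ((j' : ℕ) + 1) - 1 : ℕ) * (B₃ : ℝ) ^ (((j : ℕ) + 1) + ((j' : ℕ) + 1) - 1))) / 2) + (if j = j' then (∑ j' : Fin J, ((1 / ((((j : ℕ) + 1) + ((j' : ℕ) + 1) - 1 : ℕ) * (((B₃ - 1 : ℕ) : ℝ)) ^ (((j : ℕ) + 1) + ((j' : ℕ) + 1) - 1)) - 1 / ((((j : ℕ) + 1) + ((j' : ℕ) + 1) - 1 : ℕ) * (B₃ : ℝ) ^ (((j : ℕ) + 1) + ((j' : ℕ) + 1) - 1))) / 2) * lam j' / lam j) else 0)) * ((-1 : ℝ) ^ (if (i : ℕ) % 2 = 1 then ((((i : ℕ) + 1) / 2 : ℕ) : ℤ) else -((((i : ℕ) / 2 : ℕ) : ℤ))) * (-((((if (i : ℕ) % 2 =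 1 then ((((i : ℕ) + 1) / 2 : ℕ) : ℤ) else -((((i : ℕ) / 2 : ℕ) : ℤ))) : ℤ) : ℝ) ^ (j : ℕ)) * ((Complex.digamma (1 / 4 + ((freq a (if (i : ℕ) % 2 = 1 then ((((i : ℕ) + 1) / 2 : ℕ) : ℤ) else -((((i : ℕ) / 2 : ℕ) : ℤ))) : ℝ) : ℂ) / 2 * I)).im / 2 + (∑ k ∈ weilPrimeIndex a, (Λ k : ℝ) / Real.sqrt k * ((χ (k : ZMod q)).re * Real.sin (freq a (if (i : ℕ) % 2 = 1 then ((((i : ℕ) + 1) / 2 : ℕ) : ℤ) else -((((i : ℕ) / 2 : ℕ) : ℤ))) * Real.log k) + (χ (k : ZMod q)).im * Real.cos (freq a (if (i : ℕ) % 2 = 1 then ((((i : ℕ) + 1) / 2 : ℕ) : ℤ) else -((((i : ℕ) / 2 : ℕ) : ℤ))) * Real.log k))) - archExpSumSin a (if (i : ℕ) % 2 = 1 then ((((i : ℕ) + 1) / 2 : ℕ) : ℤ) else -((((i : ℕ) / 2 : ℕ) : ℤ)))) / π)) * ((-1 : ℝ) ^ (if (i' : ℕ) % 2 = 1 then ((((i'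 : ℕ) + 1) / 2 : ℕ) : ℤ) else -((((i' : ℕ) / 2 : ℕ) : ℤ))) * (-((((if (i' : ℕ) % 2 = 1 then ((((i' : ℕ) + 1) / 2 : ℕ) : ℤ) else -((((i' : ℕ) / 2 : ℕ) : ℤ))) : ℤ) : ℝ) ^ (j' : ℕ)) * ((Complex.digamma (1 / 4 + ((freq a (if (i' : ℕ) % 2 = 1 then ((((i' : ℕ) + 1) / 2 : ℕ) : ℤ) else -((((i' : ℕ) / 2 : ℕ) : ℤ))) : ℝ) : ℂ) / 2 * I)).im / 2 + (∑ k ∈ weilPrimeIndex a, (Λ k : ℝ) / Real.sqrt k * ((χ (k : ZMod q)).re * Real.sin (freq a (if (i' : ℕ) % 2 = 1 then ((((i' : ℕ) + 1) / 2 : ℕ) : ℤ) else -((((i' : ℕ) / 2 : ℕ) : ℤ))) * Real.log k) + (χ (k : ZMod q)).im * Real.cos (freq a (if (i' : ℕ) % 2 = 1 then ((((i' : ℕ) + 1) / 2 : ℕ) : ℤ) else -((((i' : ℕ) / 2 : ℕ) : ℤ))) * Real.log k))) - archExpSumSin a (if (i' : ℕ) % 2 = 1 then ((((i' : ℕ)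 + 1) / 2 : ℕ) : ℤ) else -((((i' : ℕ) / 2 : ℕ) : ℤ)))) / π)))
            + (if i = i' then (1 + θ⁻¹) * (((2 * B - 1 : ℕ) : ℝ) / (d₀ * ((2 * J + 1 : ℕ) * (((B₃ - 1 : ℕ) : ℝ)) ^ (2 * J + 1)))) * (4 * (π / 4 + (∑ k ∈ weilPrimeIndex a, (Λ k : ℝ) / Real.sqrt k) + a * (1 + weilArchDensity (2 * a)) / π) * (((if (i : ℕ) % 2 = 1 then ((((i : ℕ) + 1) / 2 : ℕ) : ℤ) else -((((i : ℕ) / 2 : ℕ) : ℤ)))).natAbs : ℝ) ^ J / π) ^ 2 else 0))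
          + ((1 + θ) * (1 + η) * ((π / 4 + (∑ k ∈ weilPrimeIndex a, (Λ k : ℝ) / Real.sqrt k) + a * (1 + weilArchDensity (2 * a)) / (π * B₃)) ^ 2 / (π ^ 2 * d₀)) * (∑ j : Fin J, ∑ j' : Fin J, (((1 / ((((j : ℕ) + 1) + ((j' : ℕ) + 1) - 1 : ℕ) * (((B₃ - 1 : ℕ) : ℝ)) ^ (((j : ℕ) + 1) + ((j' : ℕ) + 1) - 1)) + 1 / ((((j : ℕ) + 1) + ((j' : ℕ) + 1) - 1 : ℕ) * (B₃ : ℝ) ^ (((j : ℕ) + 1) + ((j' : ℕ) + 1) - 1))) / 2) + (if j = j' then (∑ j' : Fin J, ((1 / ((((j : ℕ) + 1) + ((j' : ℕ) + 1) - 1 : ℕ) * (((B₃ - 1 : ℕ) : ℝ)) ^ (((j : ℕ) + 1) + ((j' : ℕ) + 1) - 1)) - 1 / ((((j : ℕ) + 1) + ((j' : ℕ) + 1) - 1 : ℕ) * (B₃ : ℝ) ^ (((j : ℕ) + 1) + ((j' : ℕ) + 1) - 1))) / 2) * lam j' / lam j) else 0)) * ((-1 : ℝ) ^ ((j : ℕ)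 + 1) * ((-1 : ℝ) ^ (if (i : ℕ) % 2 = 1 then ((((i : ℕ) + 1) / 2 : ℕ) : ℤ) else -((((i : ℕ) / 2 : ℕ) : ℤ))) * (((if (i : ℕ) % 2 = 1 then ((((i : ℕ) + 1) / 2 : ℕ) : ℤ) else -((((i : ℕ) / 2 : ℕ) : ℤ))) : ℤ) : ℝ) ^ (j : ℕ))) * ((-1 : ℝ) ^ ((j' : ℕ) + 1) * ((-1 : ℝ) ^ (if (i' : ℕ) % 2 = 1 then ((((i' : ℕ) + 1) / 2 : ℕ) : ℤ) else -((((i' : ℕ) / 2 : ℕ) : ℤ))) * (((if (i' : ℕ) % 2 = 1 then ((((i' : ℕ) + 1) / 2 : ℕ) : ℤ) else -((((i' : ℕ) / 2 : ℕ) : ℤ))) : ℤ) : ℝ) ^ (j' : ℕ))))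
            + (1 + θ) * (1 + η⁻¹) * (1 / d₀) * (∑ j : Fin J, ∑ j' : Fin J, (((1 / ((((j : ℕ) + 1) + ((j' : ℕ) + 1) - 1 : ℕ) * (((B₃ - 1 : ℕ) : ℝ)) ^ (((j : ℕ) + 1) + ((j' : ℕ) + 1) - 1)) + 1 / ((((j : ℕ) + 1) + ((j' : ℕ) + 1) - 1 : ℕ) * (B₃ : ℝ) ^ (((j : ℕ) + 1) + ((j' : ℕ) + 1) - 1))) / 2) + (if j = j' then (∑ j' : Fin J, ((1 / ((((j : ℕ) + 1) + ((j' : ℕ) + 1) - 1 : ℕ) * (((B₃ - 1 : ℕ) : ℝ)) ^ (((j : ℕ) + 1) + ((j' : ℕ) + 1) - 1)) - 1 / ((((j : ℕ) + 1) + ((j' : ℕ) + 1) - 1 : ℕ) * (B₃ : ℝ) ^ (((j : ℕ) + 1) + ((j' : ℕ) + 1) - 1))) / 2) * lam j' / lam j) else 0)) * ((-1 : ℝ) ^ ((j : ℕ) + 1) * ((-1 : ℝ) ^ (if (i : ℕ) % 2 = 1 then ((((i : ℕ) + 1) / 2 : ℕ) : ℤ) else -((((i : ℕ) / 2 : ℕ)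 : ℤ))) * (-((((if (i : ℕ) % 2 = 1 then ((((i : ℕ) + 1) / 2 : ℕ) : ℤ) else -((((i : ℕ) / 2 : ℕ) : ℤ))) : ℤ) : ℝ) ^ (j : ℕ)) * ((Complex.digamma (1 / 4 + ((freq a (if (i : ℕ) % 2 = 1 then ((((i : ℕ) + 1) / 2 : ℕ) : ℤ) else -((((i : ℕ) / 2 : ℕ) : ℤ))) : ℝ) : ℂ) / 2 * I)).im / 2 + (∑ k ∈ weilPrimeIndex a, (Λ k : ℝ) / Real.sqrt k * ((χ (k : ZMod q)).re * Real.sin (freq a (if (i : ℕ) % 2 = 1 then ((((i : ℕ) + 1) / 2 : ℕ) : ℤ) else -((((i : ℕ) / 2 : ℕ) : ℤ))) * Real.log k) + (χ (k : ZMod q)).im * Real.cos (freq a (if (i : ℕ) % 2 = 1 then ((((i : ℕ) + 1) / 2 : ℕ) : ℤ) else -((((i : ℕ) / 2 : ℕ) : ℤ))) * Real.log k))) - archExpSumSin a (if (i : ℕ) % 2 = 1 then ((((i : ℕ) + 1) / 2 : ℕ) : ℤ) else -((((i : ℕ) / 2 : ℕ) : ℤ)))) / π))) * ((-1 : ℝ)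 ^ ((j' : ℕ) + 1) * ((-1 : ℝ) ^ (if (i' : ℕ) % 2 = 1 then ((((i' : ℕ) + 1) / 2 : ℕ) : ℤ) else -((((i' : ℕ) / 2 : ℕ) : ℤ))) * (-((((if (i' : ℕ) % 2 = 1 then ((((i' : ℕ) + 1) / 2 : ℕ) : ℤ) else -((((i' : ℕ) / 2 : ℕ) : ℤ))) : ℤ) : ℝ) ^ (j' : ℕ)) * ((Complex.digamma (1 / 4 + ((freq a (if (i' : ℕ) % 2 = 1 then ((((i' : ℕ) + 1) / 2 : ℕ) : ℤ) else -((((i' : ℕ) / 2 : ℕ) : ℤ))) : ℝ) : ℂ) / 2 * I)).im / 2 + (∑ k ∈ weilPrimeIndex a, (Λ k : ℝ) / Real.sqrt k * ((χ (k : ZMod q)).re * Real.sin (freq a (if (i' : ℕ) % 2 = 1 then ((((i' : ℕ) + 1) / 2 : ℕ) : ℤ) else -((((i' : ℕ) / 2 : ℕ) : ℤ))) * Real.log k) + (χ (k : ZMod q)).im * Real.cos (freq a (if (i' : ℕ) % 2 = 1 then ((((i' : ℕ) + 1) / 2 : ℕ) : ℤ) else -((((i' : ℕ) / 2 : ℕ)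 : ℤ))) * Real.log k))) - archExpSumSin a (if (i' : ℕ) % 2 = 1 then ((((i' : ℕ) + 1) / 2 : ℕ) : ℤ) else -((((i' : ℕ) / 2 : ℕ) : ℤ)))) / π))))
            + (if i = i' then (1 + θ⁻¹) * (((2 * B - 1 : ℕ) : ℝ) / (d₀ * ((2 * J + 1 : ℕ) * (((B₃ - 1 : ℕ) : ℝ)) ^ (2 * J + 1)))) * (4 * (π / 4 + (∑ k ∈ weilPrimeIndex a, (Λ k : ℝ) / Real.sqrt k) + a * (1 + weilArchDensity (2 * a)) / π) * (((if (i : ℕ) % 2 = 1 then ((((i : ℕ) + 1) / 2 : ℕ) : ℤ) else -((((i : ℕ) / 2 : ℕ) : ℤ)))).natAbs : ℝ) ^ J / π) ^ 2 else 0))) *ᵥ x := by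
  refine (complex_tailJ_majorant_enum χ ha hB hBB J lam hlam d hd₀ hd hθ hη N' x).trans (le_of_eq ?_)
  rw [dotProduct_mulVec_eq_sum_sum]
  simp only [Matrix.of_apply]
  have hsplit : ∀ (E₁ E₂ : Fin (2 * B - 1) → Fin (2 * B - 1) → ℝ),
      ∑ i, ∑ i', x i * x i' * (E₁ i i' + E₂ i i') = (∑ i, ∑ i', x i * x i' * E₁ i i') + ∑ i, ∑ i', x i * x i' * E₂ i i' := by
    intro E₁ E₂
    rw [← Finset.sum_add_distrib]
    refine Finset.sum_congr rfl fun i _ ↦ ?_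
    rw [← Finset.sum_add_distrib]
    exact Finset.sum_congr rfl fun i' _ ↦ by ring
  rw [hsplit (fun i i' ↦ (1 + θ) * (1 + η) * ((π / 4 + (∑ k ∈ weilPrimeIndex a, (Λ k : ℝ) / Real.sqrt k) + a * (1 + weilArchDensity (2 * a)) / (π * B₃)) ^ 2 / (π ^ 2 * d₀)) * (∑ j : Fin J, ∑ j' : Fin J, (((1 / ((((j : ℕ) + 1) + ((j' : ℕ) + 1) - 1 : ℕ) * (((B₃ - 1 : ℕ) : ℝ)) ^ (((j : ℕ) + 1) + ((j' : ℕ) + 1) - 1)) + 1 / ((((j : ℕ) + 1) + ((j' : ℕ) + 1) - 1 : ℕ) * (B₃ : ℝ) ^ (((j : ℕ) + 1) + ((j' : ℕ) + 1) - 1))) / 2) + (if j = j' then (∑ j' : Fin J, ((1 / ((((j : ℕ) + 1) + ((j' : ℕ) + 1) - 1 : ℕ) * (((B₃ - 1 : ℕ) : ℝ)) ^ (((j : ℕ) + 1) + ((j' : ℕ) + 1) - 1)) - 1 / ((((j : ℕ) + 1) + ((j' : ℕ) + 1) - 1 : ℕ) * (B₃ : ℝ) ^ (((j : ℕ) + 1)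 + ((j' : ℕ) + 1) - 1))) / 2) * lam j' / lam j) else 0)) * ((-1 : ℝ) ^ (if (i : ℕ) % 2 = 1 then ((((i : ℕ) + 1) / 2 : ℕ) : ℤ) else -((((i : ℕ) / 2 : ℕ) : ℤ))) * (((if (i : ℕ) % 2 = 1 then ((((i : ℕ) + 1) / 2 : ℕ) : ℤ) else -((((i : ℕ) / 2 : ℕ) : ℤ))) : ℤ) : ℝ) ^ (j : ℕ)) * ((-1 : ℝ) ^ (if (i' : ℕ) % 2 = 1 then ((((i' : ℕ) + 1) / 2 : ℕ) : ℤ) else -((((i' : ℕ) / 2 : ℕ) : ℤ))) * (((if (i' : ℕ) % 2 = 1 then ((((i' : ℕ) + 1) / 2 : ℕ) : ℤ) else -((((i' : ℕ) / 2 : ℕ) : ℤ))) : ℤ) : ℝ) ^ (j' : ℕ)))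
            + (1 + θ) * (1 + η⁻¹) * (1 / d₀) * (∑ j : Fin J, ∑ j' : Fin J, (((1 / ((((j : ℕ) + 1) + ((j' : ℕ) + 1) - 1 : ℕ) * (((B₃ - 1 : ℕ) : ℝ)) ^ (((j : ℕ) + 1) + ((j' : ℕ) + 1) - 1)) + 1 / ((((j : ℕ) + 1) + ((j' : ℕ) + 1) - 1 : ℕ) * (B₃ : ℝ) ^ (((j : ℕ) + 1) + ((j' : ℕ) + 1) - 1))) / 2) + (if j = j' then (∑ j' : Fin J, ((1 / ((((j : ℕ) + 1) + ((j' : ℕ) + 1) - 1 : ℕ) * (((B₃ - 1 : ℕ) : ℝ)) ^ (((j : ℕ) + 1) + ((j' : ℕ) + 1) - 1)) - 1 / ((((j : ℕ) + 1) + ((j' : ℕ) + 1) - 1 : ℕ) * (B₃ : ℝ) ^ (((j : ℕ) + 1) + ((j' : ℕ) + 1) - 1))) / 2) * lam j' / lam j) else 0)) * ((-1 : ℝ) ^ (if (i : ℕ) % 2 = 1 then ((((i : ℕ) + 1) / 2 : ℕ) : ℤ) else -((((i : ℕ) / 2 : ℕ) : ℤ))) * (-((((if (i : ℕ) % 2 =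 1 then ((((i : ℕ) + 1) / 2 : ℕ) : ℤ) else -((((i : ℕ) / 2 : ℕ) : ℤ))) : ℤ) : ℝ) ^ (j : ℕ)) * ((Complex.digamma (1 / 4 + ((freq a (if (i : ℕ) % 2 = 1 then ((((i : ℕ) + 1) / 2 : ℕ) : ℤ) else -((((i : ℕ) / 2 : ℕ) : ℤ))) : ℝ) : ℂ) / 2 * I)).im / 2 + (∑ k ∈ weilPrimeIndex a, (Λ k : ℝ) / Real.sqrt k * ((χ (k : ZMod q)).re * Real.sin (freq a (if (i : ℕ) % 2 = 1 then ((((i : ℕ) + 1) / 2 : ℕ) : ℤ) else -((((i : ℕ) / 2 : ℕ) : ℤ))) * Real.log k) + (χ (k : ZMod q)).im * Real.cos (freq a (if (i : ℕ) % 2 = 1 then ((((i : ℕ) + 1) / 2 : ℕ) : ℤ) else -((((i : ℕ) / 2 : ℕ) : ℤ))) * Real.log k))) - archExpSumSin a (if (i : ℕ) % 2 = 1 then ((((i : ℕ) + 1) / 2 : ℕ) : ℤ) else -((((i : ℕ) / 2 : ℕ) : ℤ)))) / π)) * ((-1 : ℝ) ^ (if (i' : ℕ) % 2 = 1 then ((((i'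 : ℕ) + 1) / 2 : ℕ) : ℤ) else -((((i' : ℕ) / 2 : ℕ) : ℤ))) * (-((((if (i' : ℕ) % 2 = 1 then ((((i' : ℕ) + 1) / 2 : ℕ) : ℤ) else -((((i' : ℕ) / 2 : ℕ) : ℤ))) : ℤ) : ℝ) ^ (j' : ℕ)) * ((Complex.digamma (1 / 4 + ((freq a (if (i' : ℕ) % 2 = 1 then ((((i' : ℕ) + 1) / 2 : ℕ) : ℤ) else -((((i' : ℕ) / 2 : ℕ) : ℤ))) : ℝ) : ℂ) / 2 * I)).im / 2 + (∑ k ∈ weilPrimeIndex a, (Λ k : ℝ) / Real.sqrt k * ((χ (k : ZMod q)).re * Real.sin (freq a (if (i' : ℕ) % 2 = 1 then ((((i' : ℕ) + 1) / 2 : ℕ) : ℤ) else -((((i' : ℕ) / 2 : ℕ) : ℤ))) * Real.log k) + (χ (k : ZMod q)).im * Real.cos (freq a (if (i' : ℕ) % 2 = 1 then ((((i' : ℕ) + 1) / 2 : ℕ) : ℤ) else -((((i' : ℕ) / 2 : ℕ) : ℤ))) * Real.log k))) - archExpSumSin a (if (i' : ℕ) % 2 = 1 then ((((i' : ℕ)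 + 1) / 2 : ℕ) : ℤ) else -((((i' : ℕ) / 2 : ℕ) : ℤ)))) / π)))
            + (if i = i' then (1 + θ⁻¹) * (((2 * B - 1 : ℕ) : ℝ) / (d₀ * ((2 * J + 1 : ℕ) * (((B₃ - 1 : ℕ) : ℝ)) ^ (2 * J + 1)))) * (4 * (π / 4 + (∑ k ∈ weilPrimeIndex a, (Λ k : ℝ) / Real.sqrt k) + a * (1 + weilArchDensity (2 * a)) / π) * (((if (i : ℕ) % 2 = 1 then ((((i : ℕ) + 1) / 2 : ℕ) : ℤ) else -((((i : ℕ) / 2 : ℕ) : ℤ)))).natAbs : ℝ) ^ J / π) ^ 2 else 0)) (fun i i' ↦ (1 + θ) * (1 + η) * ((π / 4 + (∑ k ∈ weilPrimeIndex a, (Λ k : ℝ) / Real.sqrt k) + a * (1 + weilArchDensity (2 * a)) / (π * B₃)) ^ 2 / (π ^ 2 * d₀)) * (∑ j : Fin J, ∑ j' : Fin J, (((1 / ((((j : ℕ) + 1) + ((j' : ℕ) + 1) - 1 : ℕ) * (((B₃ - 1 : ℕ) : ℝ)) ^ (((j : ℕ) + 1) + ((j' : ℕ) + 1) - 1)) +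 1 / ((((j : ℕ) + 1) + ((j' : ℕ) + 1) - 1 : ℕ) * (B₃ : ℝ) ^ (((j : ℕ) + 1) + ((j' : ℕ) + 1) - 1))) / 2) + (if j = j' then (∑ j' : Fin J, ((1 / ((((j : ℕ) + 1) + ((j' : ℕ) + 1) - 1 : ℕ) * (((B₃ - 1 : ℕ) : ℝ)) ^ (((j : ℕ) + 1) + ((j' : ℕ) + 1) - 1)) - 1 / ((((j : ℕ) + 1) + ((j' : ℕ) + 1) - 1 : ℕ) * (B₃ : ℝ) ^ (((j : ℕ) + 1) + ((j' : ℕ) + 1) - 1))) / 2) * lam j' / lam j) else 0)) * ((-1 : ℝ) ^ ((j : ℕ) + 1) * ((-1 : ℝ) ^ (if (i : ℕ) % 2 = 1 then ((((i : ℕ) + 1) / 2 : ℕ) : ℤ) else -((((i : ℕ) / 2 : ℕ) : ℤ))) * (((if (i : ℕ) % 2 = 1 then ((((i : ℕ) + 1) / 2 : ℕ) : ℤ) else -((((i : ℕ) / 2 : ℕ) : ℤ))) : ℤ) : ℝ) ^ (j : ℕ))) * ((-1 : ℝ) ^ ((j' : ℕ) + 1) * ((-1 : ℝ) ^ (if (i'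 : ℕ) % 2 = 1 then ((((i' : ℕ) + 1) / 2 : ℕ) : ℤ) else -((((i' : ℕ) / 2 : ℕ) : ℤ))) * (((if (i' : ℕ) % 2 = 1 then ((((i' : ℕ) + 1) / 2 : ℕ) : ℤ) else -((((i' : ℕ) / 2 : ℕ) : ℤ))) : ℤ) : ℝ) ^ (j' : ℕ))))
            + (1 + θ) * (1 + η⁻¹) * (1 / d₀) * (∑ j : Fin J, ∑ j' : Fin J, (((1 / ((((j : ℕ) + 1) + ((j' : ℕ) + 1) - 1 : ℕ) * (((B₃ - 1 : ℕ) : ℝ)) ^ (((j : ℕ) + 1) + ((j' : ℕ) + 1) - 1)) + 1 / ((((j : ℕ) + 1) + ((j' : ℕ) + 1) - 1 : ℕ) * (B₃ : ℝ) ^ (((j : ℕ) + 1) + ((j' : ℕ) + 1) - 1))) / 2) + (if j = j' then (∑ j' : Fin J, ((1 / ((((j : ℕ) + 1) + ((j' : ℕ) + 1) - 1 : ℕ) * (((B₃ - 1 : ℕ) : ℝ)) ^ (((j : ℕ) + 1) + ((j' : ℕ) + 1) - 1)) - 1 / ((((j : ℕ) + 1) + ((j' : ℕ) + 1) - 1 :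 ℕ) * (B₃ : ℝ) ^ (((j : ℕ) + 1) + ((j' : ℕ) + 1) - 1))) / 2) * lam j' / lam j) else 0)) * ((-1 : ℝ) ^ ((j : ℕ) + 1) * ((-1 : ℝ) ^ (if (i : ℕ) % 2 = 1 then ((((i : ℕ) + 1) / 2 : ℕ) : ℤ) else -((((i : ℕ) / 2 : ℕ) : ℤ))) * (-((((if (i : ℕ) % 2 = 1 then ((((i : ℕ) + 1) / 2 : ℕ) : ℤ) else -((((i : ℕ) / 2 : ℕ) : ℤ))) : ℤ) : ℝ) ^ (j : ℕ)) * ((Complex.digamma (1 / 4 + ((freq a (if (i : ℕ) % 2 = 1 then ((((i : ℕ) + 1) / 2 : ℕ) : ℤ) else -((((i : ℕ) / 2 : ℕ) : ℤ))) : ℝ) : ℂ) / 2 * I)).im / 2 + (∑ k ∈ weilPrimeIndex a, (Λ k : ℝ) / Real.sqrt k * ((χ (k : ZMod q)).re * Real.sin (freq a (if (i : ℕ) % 2 = 1 then ((((i : ℕ) + 1) / 2 : ℕ) : ℤ) else -((((i : ℕ) / 2 : ℕ) : ℤ))) * Real.log k) + (χ (k : ZMod q)).im * Real.cos (freq a (if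 (i : ℕ) % 2 = 1 then ((((i : ℕ) + 1) / 2 : ℕ) : ℤ) else -((((i : ℕ) / 2 : ℕ) : ℤ))) * Real.log k))) - archExpSumSin a (if (i : ℕ) % 2 = 1 then ((((i : ℕ) + 1) / 2 : ℕ) : ℤ) else -((((i : ℕ) / 2 : ℕ) : ℤ)))) / π))) * ((-1 : ℝ) ^ ((j' : ℕ) + 1) * ((-1 : ℝ) ^ (if (i' : ℕ) % 2 = 1 then ((((i' : ℕ) + 1) / 2 : ℕ) : ℤ) else -((((i' : ℕ) / 2 : ℕ) : ℤ))) * (-((((if (i' : ℕ) % 2 = 1 then ((((i' : ℕ) + 1) / 2 : ℕ) : ℤ) else -((((i' : ℕ) / 2 : ℕ) : ℤ))) : ℤ) : ℝ) ^ (j' : ℕ)) * ((Complex.digamma (1 / 4 + ((freq a (if (i' : ℕ) % 2 = 1 then ((((i' : ℕ) + 1) / 2 : ℕ) : ℤ) else -((((i' : ℕ) / 2 : ℕ) : ℤ))) : ℝ) : ℂ) / 2 * I)).im / 2 + (∑ k ∈ weilPrimeIndex a, (Λ k : ℝ) / Real.sqrt k * ((χ (k : ZMod q)).re * Real.sin (freq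 a (if (i' : ℕ) % 2 = 1 then ((((i' : ℕ) + 1) / 2 : ℕ) : ℤ) else -((((i' : ℕ) / 2 : ℕ) : ℤ))) * Real.log k) + (χ (k : ZMod q)).im * Real.cos (freq a (if (i' : ℕ) % 2 = 1 then ((((i' : ℕ) + 1) / 2 : ℕ) : ℤ) else -((((i' : ℕ) / 2 : ℕ) : ℤ))) * Real.log k))) - archExpSumSin a (if (i' : ℕ) % 2 = 1 then ((((i' : ℕ) + 1) / 2 : ℕ) : ℤ) else -((((i' : ℕ) / 2 : ℕ) : ℤ)))) / π))))
            + (if i = i' then (1 + θ⁻¹) * (((2 * B - 1 : ℕ) : ℝ) / (d₀ * ((2 * J + 1 : ℕ) * (((B₃ - 1 : ℕ) : ℝ)) ^ (2 * J + 1)))) * (4 * (π / 4 + (∑ k ∈ weilPrimeIndex a, (Λ k : ℝ) / Real.sqrt k) + a * (1 + weilArchDensity (2 * a)) / π) * (((if (i : ℕ) % 2 = 1 then ((((i : ℕ) + 1) / 2 : ℕ) : ℤ) else -((((i : ℕ) / 2 : ℕ) : ℤ)))).natAbs : ℝ) ^ J / π) ^ 2 else 0)),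
    sum_sum_mul_add3_eq, sum_sum_mul_add3_eq, sum_sum_mul_gram_eq, sum_sum_mul_gram_eq, sum_sum_mul_gram_eq,
    sum_sum_mul_gram_eq, sum_sum_add_ite_mul_eq, sum_sum_add_ite_mul_eq, sum_sum_add_ite_mul_eq, sum_sum_add_ite_mul_eq]

end MatrixForm

/-! ## The data-only front door for a complex character at order `J` -/

section Rung

/-- **Twisted format C for a COMPLEX character, data-only front door at tail order `J`.**  See the module docstring. -/
theorem weilPositivityOnChar_of_twistedC_formatC_dataJ (hq : q ≠ 1) (χ : DirichletCharacter ℂ q) (ha : 0 < a)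
    (M : ℕ → ℕ → ℝ) (hsymm : ∀ j j', M j j' = M j' j)
    (hM : ∀ p p' : ℤ,
      M (if 0 < p then 2 * p.natAbs - 1 else 2 * p.natAbs) (if 0 < p' then 2 * p'.natAbs - 1 else 2 * p'.natAbs)
        = (twistedGramCoeffC χ a p p').re)
    {B B₃ : ℕ} (hB : 2 ≤ B) (hBB : 2 * B ≤ B₃) (J : ℕ) (lam : Fin J → ℝ) (hlam : ∀ j, 0 < lam j)
    {θ η d₀ : ℝ} (hθ : 0 < θ) (hη : 0 < η) (w : ℕ → ℝ)
    (h0 : 0 < (2 * ((reDigammaQuarter (freq a B) - Real.log π) / 2 - 1 / (8 * (B : ℝ)) - a * (1 + weilArchDensity (2 * a)) / (π ^ 2 * (B : ℝ) ^ 2) - π / 4 - a * (1 + weilArchDensity (2 * a)) / π ^ 2 * Real.sqrt (8 / ((B - 1 : ℕ) : ℝ))) - (∑ k ∈ weilPrimeIndex a, (Λ k : ℝ) / Real.sqrt k * (2 * Real.cos (π / (⌊2 * a / Real.log k⌋₊ + 2)))) + Real.log q))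
    (hd0 : 0 < d₀ ∧ d₀ ≤ (2 * ((reDigammaQuarter (freq a B₃) - Real.log π) / 2 - 1 / (8 * (B₃ : ℝ)) - a * (1 + weilArchDensity (2 * a)) / (π ^ 2 * (B₃ : ℝ) ^ 2) - π / 4 - a * (1 + weilArchDensity (2 * a)) / π ^ 2 * Real.sqrt (8 / ((B - 1 : ℕ) : ℝ))) - (∑ k ∈ weilPrimeIndex a, (Λ k : ℝ) / Real.sqrt k * (2 * Real.cos (π / (⌊2 * a / Real.log k⌋₊ + 2)))) + Real.log q))
    (hw : ∀ j : ℕ, 2 * B - 1 ≤ j → j < 2 * B₃ - 1 → 0 < w j ∧ w j ≤ (2 * ((reDigammaQuarter (freq a ((j + 1) / 2 : ℕ)) - Real.log π) / 2 - 1 / (8 * (((j + 1) / 2 : ℕ) : ℝ)) - a * (1 + weilArchDensity (2 * a)) / (π ^ 2 * (((j + 1) / 2 : ℕ) : ℝ) ^ 2) - (π / 2 - Real.arctan (Real.sqrt ((B - 1 : ℕ) : ℝ) / Real.sqrt (((j + 1) / 2 : ℕ) : ℝ))) / 2 - a * (1 + weilArchDensity (2 * a)) / π ^ 2 * Real.sqrt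 (8 / ((B - 1 : ℕ) : ℝ))) - (∑ k ∈ weilPrimeIndex a, (Λ k : ℝ) / Real.sqrt k * (2 * Real.cos (π / (⌊2 * a / Real.log k⌋₊ + 2)))) + Real.log q))
    (hS : ∀ x : Fin (2 * B - 1) → ℝ, 0 ≤ ∑ i, ∑ i', x i * x i' *
      (M i i' - (∑ j ∈ Finset.Ico (2 * B - 1) (2 * B₃ - 1), M i j * M i' j / w j)
        - (Matrix.of fun i i' : Fin (2 * B - 1) ↦
            ((1 + θ) * (1 + η) * ((π / 4 + (∑ k ∈ weilPrimeIndex a, (Λ k : ℝ) / Real.sqrt k) + a * (1 + weilArchDensity (2 * a)) / (π * B₃)) ^ 2 / (π ^ 2 * d₀)) * (∑ j : Fin J, ∑ j' : Fin J, (((1 / ((((j : ℕ) + 1) + ((j' : ℕ) + 1) - 1 : ℕ) * (((B₃ - 1 : ℕ) : ℝ)) ^ (((j : ℕ) + 1) + ((j' : ℕ) + 1) - 1)) + 1 / ((((j : ℕ) + 1) + ((j' : ℕ) + 1) - 1 : ℕ) * (B₃ : ℝ) ^ (((j : ℕ) + 1) + ((j' : ℕ) + 1) - 1))) / 2) + (if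 j = j' then (∑ j' : Fin J, ((1 / ((((j : ℕ) + 1) + ((j' : ℕ) + 1) - 1 : ℕ) * (((B₃ - 1 : ℕ) : ℝ)) ^ (((j : ℕ) + 1) + ((j' : ℕ) + 1) - 1)) - 1 / ((((j : ℕ) + 1) + ((j' : ℕ) + 1) - 1 : ℕ) * (B₃ : ℝ) ^ (((j : ℕ) + 1) + ((j' : ℕ) + 1) - 1))) / 2) * lam j' / lam j) else 0)) * ((-1 : ℝ) ^ (if (i : ℕ) % 2 = 1 then ((((i : ℕ) + 1) / 2 : ℕ) : ℤ) else -((((i : ℕ) / 2 : ℕ) : ℤ))) * (((if (i : ℕ) % 2 = 1 then ((((i : ℕ) + 1) / 2 : ℕ) : ℤ) else -((((i : ℕ) / 2 : ℕ) : ℤ))) : ℤ) : ℝ) ^ (j : ℕ)) * ((-1 : ℝ) ^ (if (i' : ℕ) % 2 = 1 then ((((i' : ℕ) + 1) / 2 : ℕ) : ℤ) else -((((i' : ℕ) / 2 : ℕ) : ℤ))) * (((if (i' : ℕ) % 2 = 1 then ((((i' : ℕ) + 1) / 2 : ℕ) : ℤ) else -((((i' : ℕ) / 2 : ℕ) : ℤ)))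 : ℤ) : ℝ) ^ (j' : ℕ)))
              + (1 + θ) * (1 + η⁻¹) * (1 / d₀) * (∑ j : Fin J, ∑ j' : Fin J, (((1 / ((((j : ℕ) + 1) + ((j' : ℕ) + 1) - 1 : ℕ) * (((B₃ - 1 : ℕ) : ℝ)) ^ (((j : ℕ) + 1) + ((j' : ℕ) + 1) - 1)) + 1 / ((((j : ℕ) + 1) + ((j' : ℕ) + 1) - 1 : ℕ) * (B₃ : ℝ) ^ (((j : ℕ) + 1) + ((j' : ℕ) + 1) - 1))) / 2) + (if j = j' then (∑ j' : Fin J, ((1 / ((((j : ℕ) + 1) + ((j' : ℕ) + 1) - 1 : ℕ) * (((B₃ - 1 : ℕ) : ℝ)) ^ (((j : ℕ) + 1) + ((j' : ℕ) + 1) - 1)) - 1 / ((((j : ℕ) + 1) + ((j' : ℕ) + 1) - 1 : ℕ) * (B₃ : ℝ) ^ (((j : ℕ) + 1) + ((j' : ℕ) + 1) - 1))) / 2) * lam j' / lam j) else 0)) * ((-1 : ℝ) ^ (if (i : ℕ) % 2 = 1 then ((((i : ℕ) + 1) / 2 : ℕ) : ℤ) else -((((i : ℕ) / 2 : ℕ)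 : ℤ))) * (-((((if (i : ℕ) % 2 = 1 then ((((i : ℕ) + 1) / 2 : ℕ) : ℤ) else -((((i : ℕ) / 2 : ℕ) : ℤ))) : ℤ) : ℝ) ^ (j : ℕ)) * ((Complex.digamma (1 / 4 + ((freq a (if (i : ℕ) % 2 = 1 then ((((i : ℕ) + 1) / 2 : ℕ) : ℤ) else -((((i : ℕ) / 2 : ℕ) : ℤ))) : ℝ) : ℂ) / 2 * I)).im / 2 + (∑ k ∈ weilPrimeIndex a, (Λ k : ℝ) / Real.sqrt k * ((χ (k : ZMod q)).re * Real.sin (freq a (if (i : ℕ) % 2 = 1 then ((((i : ℕ) + 1) / 2 : ℕ) : ℤ) else -((((i : ℕ) / 2 : ℕ) : ℤ))) * Real.log k) + (χ (k : ZMod q)).im * Real.cos (freq a (if (i : ℕ) % 2 = 1 then ((((i : ℕ) + 1) / 2 : ℕ) : ℤ) else -((((i : ℕ) / 2 : ℕ) : ℤ))) * Real.log k))) - archExpSumSin a (if (i : ℕ) % 2 = 1 then ((((i : ℕ) + 1) / 2 : ℕ) : ℤ) else -((((i : ℕ) / 2 : ℕ) : ℤ)))) / π)) * ((-1 : ℝ)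 ^ (if (i' : ℕ) % 2 = 1 then ((((i' : ℕ) + 1) / 2 : ℕ) : ℤ) else -((((i' : ℕ) / 2 : ℕ) : ℤ))) * (-((((if (i' : ℕ) % 2 = 1 then ((((i' : ℕ) + 1) / 2 : ℕ) : ℤ) else -((((i' : ℕ) / 2 : ℕ) : ℤ))) : ℤ) : ℝ) ^ (j' : ℕ)) * ((Complex.digamma (1 / 4 + ((freq a (if (i' : ℕ) % 2 = 1 then ((((i' : ℕ) + 1) / 2 : ℕ) : ℤ) else -((((i' : ℕ) / 2 : ℕ) : ℤ))) : ℝ) : ℂ) / 2 * I)).im / 2 + (∑ k ∈ weilPrimeIndex a, (Λ k : ℝ) / Real.sqrt k * ((χ (k : ZMod q)).re * Real.sin (freq a (if (i' : ℕ) % 2 = 1 then ((((i' : ℕ) + 1) / 2 : ℕ) : ℤ) else -((((i' : ℕ) / 2 : ℕ) : ℤ))) * Real.log k) + (χ (k : ZMod q)).im * Real.cos (freq a (if (i' : ℕ) % 2 = 1 then ((((i' : ℕ) + 1) / 2 : ℕ) : ℤ) else -((((i' : ℕ) / 2 : ℕ) : ℤ))) * Real.log k))) - archExpSumSin a (if (i'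 : ℕ) % 2 = 1 then ((((i' : ℕ) + 1) / 2 : ℕ) : ℤ) else -((((i' : ℕ) / 2 : ℕ) : ℤ)))) / π)))
              + (if i = i' then (1 + θ⁻¹) * (((2 * B - 1 : ℕ) : ℝ) / (d₀ * ((2 * J + 1 : ℕ) * (((B₃ - 1 : ℕ) : ℝ)) ^ (2 * J + 1)))) * (4 * (π / 4 + (∑ k ∈ weilPrimeIndex a, (Λ k : ℝ) / Real.sqrt k) + a * (1 + weilArchDensity (2 * a)) / π) * (((if (i : ℕ) % 2 = 1 then ((((i : ℕ) + 1) / 2 : ℕ) : ℤ) else -((((i : ℕ) / 2 : ℕ) : ℤ)))).natAbs : ℝ) ^ J / π) ^ 2 else 0))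
            + ((1 + θ) * (1 + η) * ((π / 4 + (∑ k ∈ weilPrimeIndex a, (Λ k : ℝ) / Real.sqrt k) + a * (1 + weilArchDensity (2 * a)) / (π * B₃)) ^ 2 / (π ^ 2 * d₀)) * (∑ j : Fin J, ∑ j' : Fin J, (((1 / ((((j : ℕ) + 1) + ((j' : ℕ) + 1) - 1 : ℕ) * (((B₃ - 1 : ℕ) : ℝ)) ^ (((j : ℕ) + 1) + ((j' : ℕ) + 1) - 1)) + 1 / ((((j : ℕ) + 1) + ((j' : ℕ) + 1) - 1 : ℕ) * (B₃ : ℝ) ^ (((j : ℕ) + 1) + ((j' : ℕ) + 1) - 1))) / 2) + (if j = j' then (∑ j' : Fin J, ((1 / ((((j : ℕ) + 1) + ((j' : ℕ) + 1) - 1 : ℕ) * (((B₃ - 1 : ℕ) : ℝ)) ^ (((j : ℕ) + 1) + ((j' : ℕ) + 1) - 1)) - 1 / ((((j : ℕ) + 1) + ((j' : ℕ) + 1) - 1 : ℕ) * (B₃ : ℝ) ^ (((j : ℕ) + 1) + ((j' : ℕ) + 1) - 1))) / 2) * lam j' / lam j) else 0)) * ((-1 : ℝ) ^ ((j : ℕ)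 + 1) * ((-1 : ℝ) ^ (if (i : ℕ) % 2 = 1 then ((((i : ℕ) + 1) / 2 : ℕ) : ℤ) else -((((i : ℕ) / 2 : ℕ) : ℤ))) * (((if (i : ℕ) % 2 = 1 then ((((i : ℕ) + 1) / 2 : ℕ) : ℤ) else -((((i : ℕ) / 2 : ℕ) : ℤ))) : ℤ) : ℝ) ^ (j : ℕ))) * ((-1 : ℝ) ^ ((j' : ℕ) + 1) * ((-1 : ℝ) ^ (if (i' : ℕ) % 2 = 1 then ((((i' : ℕ) + 1) / 2 : ℕ) : ℤ) else -((((i' : ℕ) / 2 : ℕ) : ℤ))) * (((if (i' : ℕ) % 2 = 1 then ((((i' : ℕ) + 1) / 2 : ℕ) : ℤ) else -((((i' : ℕ) / 2 : ℕ) : ℤ))) : ℤ) : ℝ) ^ (j' : ℕ))))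
              + (1 + θ) * (1 + η⁻¹) * (1 / d₀) * (∑ j : Fin J, ∑ j' : Fin J, (((1 / ((((j : ℕ) + 1) + ((j' : ℕ) + 1) - 1 : ℕ) * (((B₃ - 1 : ℕ) : ℝ)) ^ (((j : ℕ) + 1) + ((j' : ℕ) + 1) - 1)) + 1 / ((((j : ℕ) + 1) + ((j' : ℕ) + 1) - 1 : ℕ) * (B₃ : ℝ) ^ (((j : ℕ) + 1) + ((j' : ℕ) + 1) - 1))) / 2) + (if j = j' then (∑ j' : Fin J, ((1 / ((((j : ℕ) + 1) + ((j' : ℕ) + 1) - 1 : ℕ) * (((B₃ - 1 : ℕ) : ℝ)) ^ (((j : ℕ) + 1) + ((j' : ℕ) + 1) - 1)) - 1 / ((((j : ℕ) + 1) + ((j' : ℕ) + 1) - 1 : ℕ) * (B₃ : ℝ) ^ (((j : ℕ) + 1) + ((j' : ℕ) + 1) - 1))) / 2) * lam j' / lam j) else 0)) * ((-1 : ℝ) ^ ((j : ℕ) + 1) * ((-1 : ℝ) ^ (if (i : ℕ) % 2 = 1 then ((((i : ℕ) + 1) / 2 : ℕ) : ℤ) else -((((i : ℕ) / 2 : ℕ)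 : ℤ))) * (-((((if (i : ℕ) % 2 = 1 then ((((i : ℕ) + 1) / 2 : ℕ) : ℤ) else -((((i : ℕ) / 2 : ℕ) : ℤ))) : ℤ) : ℝ) ^ (j : ℕ)) * ((Complex.digamma (1 / 4 + ((freq a (if (i : ℕ) % 2 = 1 then ((((i : ℕ) + 1) / 2 : ℕ) : ℤ) else -((((i : ℕ) / 2 : ℕ) : ℤ))) : ℝ) : ℂ) / 2 * I)).im / 2 + (∑ k ∈ weilPrimeIndex a, (Λ k : ℝ) / Real.sqrt k * ((χ (k : ZMod q)).re * Real.sin (freq a (if (i : ℕ) % 2 = 1 then ((((i : ℕ) + 1) / 2 : ℕ) : ℤ) else -((((i : ℕ) / 2 : ℕ) : ℤ))) * Real.log k) + (χ (k : ZMod q)).im * Real.cos (freq a (if (i : ℕ) % 2 = 1 then ((((i : ℕ) + 1) / 2 : ℕ) : ℤ) else -((((i : ℕ) / 2 : ℕ) : ℤ))) * Real.log k))) - archExpSumSin a (if (i : ℕ) % 2 = 1 then ((((i : ℕ) + 1) / 2 : ℕ) : ℤ) else -((((i : ℕ) / 2 : ℕ) : ℤ)))) / π))) * ((-1 : ℝ)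 ^ ((j' : ℕ) + 1) * ((-1 : ℝ) ^ (if (i' : ℕ) % 2 = 1 then ((((i' : ℕ) + 1) / 2 : ℕ) : ℤ) else -((((i' : ℕ) / 2 : ℕ) : ℤ))) * (-((((if (i' : ℕ) % 2 = 1 then ((((i' : ℕ) + 1) / 2 : ℕ) : ℤ) else -((((i' : ℕ) / 2 : ℕ) : ℤ))) : ℤ) : ℝ) ^ (j' : ℕ)) * ((Complex.digamma (1 / 4 + ((freq a (if (i' : ℕ) % 2 = 1 then ((((i' : ℕ) + 1) / 2 : ℕ) : ℤ) else -((((i' : ℕ) / 2 : ℕ) : ℤ))) : ℝ) : ℂ) / 2 * I)).im / 2 + (∑ k ∈ weilPrimeIndex a, (Λ k : ℝ) / Real.sqrt k * ((χ (k : ZMod q)).re * Real.sin (freq a (if (i' : ℕ) % 2 = 1 then ((((i' : ℕ) + 1) / 2 : ℕ) : ℤ) else -((((i' : ℕ) / 2 : ℕ) : ℤ))) * Real.log k) + (χ (k : ZMod q)).im * Real.cos (freq a (if (i' : ℕ) % 2 = 1 then ((((i' : ℕ) + 1) / 2 : ℕ) : ℤ) else -((((i' : ℕ) / 2 : ℕ)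 : ℤ))) * Real.log k))) - archExpSumSin a (if (i' : ℕ) % 2 = 1 then ((((i' : ℕ) + 1) / 2 : ℕ) : ℤ) else -((((i' : ℕ) / 2 : ℕ) : ℤ)))) / π))))
              + (if i = i' then (1 + θ⁻¹) * (((2 * B - 1 : ℕ) : ℝ) / (d₀ * ((2 * J + 1 : ℕ) * (((B₃ - 1 : ℕ) : ℝ)) ^ (2 * J + 1)))) * (4 * (π / 4 + (∑ k ∈ weilPrimeIndex a, (Λ k : ℝ) / Real.sqrt k) + a * (1 + weilArchDensity (2 * a)) / π) * (((if (i : ℕ) % 2 = 1 then ((((i : ℕ) + 1) / 2 : ℕ) : ℤ) else -((((i : ℕ) / 2 : ℕ) : ℤ)))).natAbs : ℝ) ^ J / π) ^ 2 else 0))) i i')) :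
    WeilPositivityOnChar χ a := by
  have hE0 : 0 < weilArchDensity (2 * a) := weilArchDensity_pos (by positivity)
  have hC : 0 ≤ a * (1 + weilArchDensity (2 * a)) := by positivity
  have hB1 : 1 ≤ B := by omega
  have hB₃1 : 1 ≤ B₃ := by omega
  -- the far weight as a function of the mode size
  set W : ℕ → ℝ := fun n ↦ (2 * ((reDigammaQuarter (freq a n) - Real.log π) / 2 - 1 / (8 * (n : ℝ)) - a * (1 + weilArchDensity (2 * a)) / (π ^ 2 * (n : ℝ) ^ 2) - (π / 2 - Real.arctan (Real.sqrt ((B - 1 : ℕ) : ℝ) / Real.sqrt (n : ℝ))) / 2 - a * (1 + weilArchDensity (2 * a)) / π ^ 2 * Real.sqrt (8 / ((B - 1 : ℕ) : ℝ))) - (∑ k ∈ weilPrimeIndex a, (Λ k : ℝ) / Real.sqrt k * (2 * Real.cos (π / (⌊2 * a / Real.log k⌋₊ + 2)))) + Real.log q) with hWdef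
  -- the arctan penalty is at most π/4, so `W` dominates the monotone lower profile
  have hWge : ∀ n : ℕ, (2 * ((reDigammaQuarter (freq a n) - Real.log π) / 2 - 1 / (8 * (n : ℝ)) - a * (1 + weilArchDensity (2 * a)) / (π ^ 2 * (n : ℝ) ^ 2) - π / 4 - a * (1 + weilArchDensity (2 * a)) / π ^ 2 * Real.sqrt (8 / ((B - 1 : ℕ) : ℝ))) - (∑ k ∈ weilPrimeIndex a, (Λ k : ℝ) / Real.sqrt k * (2 * Real.cos (π / (⌊2 * a / Real.log k⌋₊ + 2)))) + Real.log q) ≤ W n := by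
    intro n
    have hat : 0 ≤ Real.arctan (Real.sqrt ((B - 1 : ℕ) : ℝ) / Real.sqrt (n : ℝ)) := by
      have h := Real.arctan_strictMono.monotone (by positivity : (0 : ℝ) ≤ Real.sqrt ((B - 1 : ℕ) : ℝ) / Real.sqrt (n : ℝ))
      rwa [Real.arctan_zero] at h
    simp only [hWdef]
    linarith
  have hd : ∀ j : ℕ, 2 * B - 1 ≤ j → 0 < W ((j + 1) / 2) := by
    intro j hj
    have hm : B ≤ (j + 1) / 2 := by omega
    have hmono := even_dhat_core_mono ha hC hB1 hm
    have h := hWge ((j + 1) / 2)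
    push_cast at hmono h h0 ⊢
    linarith
  have hdmono : ∀ m : ℕ, B₃ ≤ m → d₀ ≤ W m := by
    intro m hm
    have hmono := even_dhat_core_mono ha hC hB₃1 hm
    have h := hWge m
    linarith [hd0.2]
  -- the table in mode language
  have hMij : ∀ i j : ℕ, M i j = (twistedGramCoeffC χ a
      (if i % 2 = 1 then (((i + 1) / 2 : ℕ) : ℤ) else -((i / 2 : ℕ) : ℤ))
      (if j % 2 = 1 then (((j + 1) / 2 : ℕ) : ℤ) else -((j / 2 : ℕ) : ℤ))).re := by
    intro i j
    rw [← hM, kappa_iota, kappa_iota]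
  -- hfar from the mode-level bound, on real vectors
  have hfar : ∀ (N' : ℕ) (y : ℕ → ℝ),
      ∑ j ∈ Finset.Ico (2 * B - 1) N', W ((j + 1) / 2) * y j ^ 2
        ≤ ∑ j ∈ Finset.Ico (2 * B - 1) N', ∑ j' ∈ Finset.Ico (2 * B - 1) N', y j * M j j' * y j' := by
    intro N' y
    set v : ℕ → ℝ := fun j ↦ if 2 * B - 1 ≤ j ∧ j < N' then y j else 0 with hv
    have hvz : ∀ j, ¬ (2 * B - 1 ≤ j ∧ j < N') → v j = 0 := fun j hj ↦ by simp only [hv, if_neg hj]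
    have hsub : Finset.Ico (2 * B - 1) N' ⊆ Finset.range (2 * N' + 1) := fun j hj ↦ by
      rw [Finset.mem_Ico] at hj; rw [Finset.mem_range]; omega
    have hl : ∑ j ∈ Finset.Ico (2 * B - 1) N', W ((j + 1) / 2) * y j ^ 2
        = ∑ j ∈ Finset.range (2 * N' + 1), W ((j + 1) / 2) * v j ^ 2 := by
      rw [← Finset.sum_subset hsub (fun j _ hj ↦ by
        rw [hvz j (by rwa [Finset.mem_Ico] at hj)]; ring)]
      refine Finset.sum_congr rfl fun j hj ↦ ?_
      rw [Finset.mem_Ico] at hj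
      simp only [hv, if_pos hj]
    have hr : ∑ j ∈ Finset.Ico (2 * B - 1) N', ∑ j' ∈ Finset.Ico (2 * B - 1) N', y j * M j j' * y j'
        = ∑ j ∈ Finset.range (2 * N' + 1), ∑ j' ∈ Finset.range (2 * N' + 1), v j * v j' * M j j' := by
      rw [← Finset.sum_subset hsub (fun j _ hj ↦ by
        refine Finset.sum_eq_zero fun j' _ ↦ ?_
        rw [hvz j (by rwa [Finset.mem_Ico] at hj)]; ring)]
      refine Finset.sum_congr rfl fun j hj ↦ ?_
      rw [← Finset.sum_subset hsub (fun j' _ hj' ↦ by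
        rw [hvz j' (by rwa [Finset.mem_Ico] at hj')]; ring)]
      refine Finset.sum_congr rfl fun j' hj' ↦ ?_
      rw [Finset.mem_Ico] at hj hj'
      simp only [hv, if_pos hj, if_pos hj']
      ring
    rw [hl, hr, sum_range_enum (fun j ↦ W ((j + 1) / 2) * v j ^ 2) N',
      sum_sum_range_enum (fun j j' ↦ v j * v j' * M j j') N']
    simp_rw [modeAbs_kappa, hM]
    have key := re_twistedGramCoeffC_modes_far_ge χ ha hB N'
      (fun p ↦ ((v (if 0 < p then 2 * p.natAbs - 1 else 2 * p.natAbs) : ℝ) : ℂ)) (fun p hp ↦ ?_) (fun p hp ↦ ?_)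
    · rw [re_sum_sum_conj_mul_twistedGramCoeffC] at key
      simp only [Complex.ofReal_re, Complex.ofReal_im, mul_zero, add_zero, Complex.norm_real, Real.norm_eq_abs,
        sq_abs] at key
      simpa only [hWdef] using key
    · have h0' := hvz _ (fun h ↦ absurd h.1 (not_le.mpr (kappa_lt_of_natAbs_lt hp)))
      rw [h0']; simp
    · have h0' := hvz _ (fun h ↦ absurd h.2 (not_lt.mpr ((by omega : N' ≤ 2 * N' + 1).trans
        (le_kappa_of_lt_natAbs hp))))
      rw [h0']; simp
  -- exact columns and the order-J tail
  have hU1 : ∀ x : Fin (2 * B - 1) → ℝ,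
      ∑ j ∈ Finset.Ico (2 * B - 1) (2 * B₃ - 1), (∑ i : Fin (2 * B - 1), M i j * x i) ^ 2 / W ((j + 1) / 2)
        ≤ x ⬝ᵥ (Matrix.of fun i i' : Fin (2 * B - 1) ↦
            ∑ j ∈ Finset.Ico (2 * B - 1) (2 * B₃ - 1), M i j * M i' j / w j) *ᵥ x :=
    fun x ↦ columns_majorant (Finset.Ico (2 * B - 1) (2 * B₃ - 1)) (fun j i ↦ M i j) (fun j ↦ W ((j + 1) / 2)) w
      (fun j hj ↦ by
        have hj := Finset.mem_Ico.mp hj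
        have h := hw j hj.1 hj.2
        simp only [hWdef]
        exact h) x
  have hU2 := fun (N' : ℕ) (x : Fin (2 * B - 1) → ℝ) ↦
    complex_tailJ_majorant_matrix χ ha hB1 hBB J lam hlam W hd0.1 hdmono hθ hη N' x
  refine weilPositivityOnChar_of_twistedGramCoeffC_re_psd hq χ ha fun N x ↦ ?_
  set v : ℕ → ℝ := fun j ↦ x (if j % 2 = 1 then (((j + 1) / 2 : ℕ) : ℤ) else -((j / 2 : ℕ) : ℤ)) with hv
  have key := sum_range_mul_mul_nonneg_of_certificate_sum_split M hsymm (2 * B - 1) (2 * B₃ - 1) (by omega)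
    (fun j ↦ W ((j + 1) / 2)) _ _ hd hfar hU1 (fun N' x ↦ by
      have h := hU2 N' x
      simp only [← hMij] at h
      simp only [hWdef] at h ⊢
      exact h) (fun x ↦ by
      have h := hS x
      simp only [Matrix.of_apply] at h ⊢
      exact h) (2 * N + 1) v
  rw [sum_sum_range_enum (fun j j' ↦ v j * v j' * M j j') N] at key
  have hx : ∀ p : ℤ, v (if 0 < p then 2 * p.natAbs - 1 else 2 * p.natAbs) = x p := fun p ↦ by
    simp only [hv]
    split_ifs <;> first | omega | (congr 1; omega)
  simp_rw [hx, hM] at key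
  exact key

end Rung

end Summit.Ventures.WeilGRH

end
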